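import Literature.Topology.FourManifolds.SeifertAlgebraicModelsReduction
import Literature.Topology.FourManifolds.SeifertAlgebraicModelsDefiningFunction
import Literature.Topology.FourManifolds.SeifertAlgebraicModelsSides
import Literature.Topology.FourManifolds.SmoothEmbeddingComp
import Mathlib.Topology.Connected.LocallyConnected
import HarnessLib

/-!
# Seifert's algebraic models: assembly, modulo the separation theorem

Topic `Literature/Topology/FourManifolds` (ninth rung of the proof of the named fact
`Literature.Topology.FourManifolds.Seifert1936_algebraicModel`, `SeifertAlgebraicModels.lean`).
**Everything in this file is proved; no named fact is introduced.**

This file assembles the previous rungs into Seifert's theorem (Akbulut–King, *Topology of Real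
Algebraic Sets* (1992), Ch. II, Thm. 2.8.2 for `V = ℝⁿ`) **from the separation property of
compact connected hypersurfaces**, which is kept as an explicit hypothesis of the main theorem
(`Seifert1936_algebraicModel_of_separation`; it is the Jordan–Brouwer separation theorem, the
content of "since `M` is homologous to `W = ∅`, there is a compact set `N` so that `M` is the
frontier of `N`" in Assertion 2.8.2.1, PDF p. 71):

* `Literature.Topology.FourManifolds.isSmoothEmbedding_comp_subtypeVal_opens` — a smooth
  embedding restricts to a smooth embedding of every open submanifold (here: a connected
  component);
* `Literature.Topology.FourManifolds.exists_definingFunction_of_separation` — for `m ≥ 1` and a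
  compact `M`, given separation for the components of `M`: a smooth `g` with regular zero set
  `e(M)` and `g ≥ 1` off a ball (the product of the defining functions of the components,
  `exists_sides_of_not_isPreconnected`, `exists_definingFunction_of_sides`);
* `Literature.Topology.FourManifolds.Seifert1936_algebraicModel_dim_zero` — the case `m = 0`
  (finitely many points on the line: `f = ∏ (X - e(y))`, constant isotopy);
* `Literature.Topology.FourManifolds.Seifert1936_algebraicModel_of_separation` (**main
  result**) — separation of `ℝᵐ⁺¹` by every compact connected smoothly embedded `m`-manifold
  (`m ≥ 1`) implies `Seifert1936_algebraicModel`.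

## References

* S. Akbulut, H. King, *Topology of Real Algebraic Sets*, MSRI Publ. 25, Springer (1992), Ch. II,
  Thm. 2.8.2 and its proof (PDF pp. 70–72). [AkbulutKing1992]
* H. Seifert, *Algebraische Approximation von Mannigfaltigkeiten*, Math. Z. 41 (1936) 1–17.
  [Seifert1936]
-/

open scoped Manifold ContDiff Topology
open Function Set Filter Metric Manifold MvPolynomial

noncomputable section

namespace Literature.Topology.FourManifolds

universe u

/-! ### Restriction of a smooth embedding to an open submanifold -/

section Opens

variable {EM HM : Type*} [NormedAddCommGroup EM] [NormedSpace ℝ EM] [TopologicalSpace HM]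
  {I : ModelWithCorners ℝ EM HM} {X : Type*} [TopologicalSpace X] [ChartedSpace HM X]

/-- The coercion partial homeomorphism `U ⇀ X` of an open subset is smooth. [folklore] -/
theorem contMDiffOn_opensSubtypeCoe (U : TopologicalSpace.Opens X) (hU : Nonempty U) :
    ContMDiffOn I I ∞ (U.openPartialHomeomorphSubtypeCoe hU)
      (U.openPartialHomeomorphSubtypeCoe hU).source := by
  rw [TopologicalSpace.Opens.openPartialHomeomorphSubtypeCoe_source]
  exact (contMDiff_subtype_val.contMDiffOn (s := univ)).congr fun z _ => by simp

/-- The inverse of the coercion partial homeomorphism `U ⇀ X` of an open subset is smooth on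
`U`. [folklore] -/
theorem contMDiffOn_opensSubtypeCoe_symm (U : TopologicalSpace.Opens X) (hU : Nonempty U) :
    ContMDiffOn I I ∞ (U.openPartialHomeomorphSubtypeCoe hU).symm
      (U.openPartialHomeomorphSubtypeCoe hU).target := by
  set c := U.openPartialHomeomorphSubtypeCoe hU
  have key : EqOn (Subtype.val ∘ c.symm) id c.target := fun w hw => c.right_inv hw
  intro z hz
  have h1 : ContMDiffWithinAt I I ∞ (Subtype.val ∘ c.symm) c.target z :=
    contMDiffWithinAt_id.congr key (key hz)
  exact (ContMDiffWithinAt.subtypeVal_comp_iff U _ _ _).1 h1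

/-- **A smooth embedding restricts to a smooth embedding of any open submanifold** (Lee,
*Introduction to Smooth Manifolds* (2013), Ch. 5). [folklore] -/
theorem isSmoothEmbedding_comp_subtypeVal_opens [IsManifold I ∞ X]
    {EN HN : Type*} [NormedAddCommGroup EN] [NormedSpace ℝ EN] [TopologicalSpace HN]
    {J : ModelWithCorners ℝ EN HN} {N : Type*} [TopologicalSpace N] [ChartedSpace HN N]
    (W : TopologicalSpace.Opens X) {f : X → N} (hf : IsSmoothEmbedding I J ∞ f) :
    IsSmoothEmbedding I J ∞ (f ∘ (Subtype.val : ↥W → X)) := by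
  rcases isEmpty_or_nonempty ↥W with hE | hne
  · exact ⟨IsImmersionOfComplement.isImmersion (F := Unit) fun x => isEmptyElim x,
      hf.isEmbedding.comp Topology.IsEmbedding.subtypeVal⟩
  · have hΦ := hf.comp_openPartialHomeomorph (W.openPartialHomeomorphSubtypeCoe hne) (by simp)
      (contMDiffOn_opensSubtypeCoe _ hne) (contMDiffOn_opensSubtypeCoe_symm _ hne)
    rwa [TopologicalSpace.Opens.openPartialHomeomorphSubtypeCoe_coe] at hΦ

end Opens

/-! ### The defining function of a compact hypersurface, from separation of its components -/

/-- **The defining function of a compact hypersurface, given separation** (Akbulut–King,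
Assertion 2.8.2.1 with `W = ∅`).  Let `m ≥ 1` and suppose every compact connected smoothly
embedded `m`-manifold separates `ℝᵐ⁺¹`.  Then for every smooth embedding `e : M → ℝᵐ⁺¹` of a
compact `m`-manifold there is a smooth `g` with `g⁻¹(0) = e(M)`, `Dg ≠ 0` on `e(M)` and `g ≥ 1`
off a ball: the product over the (finitely many) components `Mᵢ` of `M` of the defining
functions of the two-sided separating hypersurfaces `e(Mᵢ)`.
[cite: AkbulutKing1992, Ch. II proof of Thm. 2.8.2, Assertion 2.8.2.1 (W = ∅)] -/
theorem exists_definingFunction_of_separation {m : ℕ} (hm : 1 ≤ m)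
    (hsep : ∀ (M : Type u) [TopologicalSpace M] [CompactSpace M] [ConnectedSpace M]
      [ChartedSpace (EuclideanSpace ℝ (Fin m)) M] [IsManifold (𝓡 m) ∞ M]
      (e : M → EuclideanSpace ℝ (Fin (m + 1))),
      IsSmoothEmbedding (𝓡 m) (𝓡 (m + 1)) ∞ e → ¬ IsPreconnected (range e)ᶜ)
    {M : Type u} [TopologicalSpace M] [CompactSpace M]
    [ChartedSpace (EuclideanSpace ℝ (Fin m)) M] [IsManifold (𝓡 m) ∞ M]
    (e : M → EuclideanSpace ℝ (Fin (m + 1))) (he : IsSmoothEmbedding (𝓡 m) (𝓡 (m + 1)) ∞ e) :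
    ∃ g : EuclideanSpace ℝ (Fin (m + 1)) → ℝ, ContDiff ℝ ∞ g ∧
      (∀ x, g x = 0 ↔ x ∈ range e) ∧ (∀ x, g x = 0 → fderiv ℝ g x ≠ 0) ∧
      ∃ R : ℝ, ∀ x, R ≤ ‖x‖ → 1 ≤ g x := by
  classical
  haveI : LocallyConnectedSpace M :=
    ChartedSpace.locallyConnectedSpace (EuclideanSpace ℝ (Fin m)) M
  haveI : Fintype (ConnectedComponents M) := Fintype.ofFinite _
  have hinj : Injective e := he.isEmbedding.injective
  -- the components as open submanifolds
  set W : ConnectedComponents M → TopologicalSpace.Opens M := fun c =>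
    ⟨ConnectedComponents.mk ⁻¹' {c}, (isOpen_discrete {c}).preimage
      ConnectedComponents.continuous_coe⟩ with hW_def
  have hWeq : ∀ y : M, ((W (ConnectedComponents.mk y) : TopologicalSpace.Opens M) : Set M) =
      connectedComponent y := fun y => connectedComponents_preimage_singleton
  haveI hWc : ∀ c, CompactSpace ↥(W c) := fun c => by
    obtain ⟨y, rfl⟩ := ConnectedComponents.surjective_coe c
    have h : IsCompact ((W (ConnectedComponents.mk y) : TopologicalSpace.Opens M) : Set M) := by
      rw [hWeq]; exact isClosed_connectedComponent.isCompact
    exact isCompact_iff_compactSpace.1 h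
  haveI hWconn : ∀ c, ConnectedSpace ↥(W c) := fun c => by
    obtain ⟨y, rfl⟩ := ConnectedComponents.surjective_coe c
    have h : IsConnected ((W (ConnectedComponents.mk y) : TopologicalSpace.Opens M) : Set M) := by
      rw [hWeq]; exact isConnected_connectedComponent
    exact isConnected_iff_connectedSpace.1 h
  -- the embeddings of the components, their sides and defining functions
  have hec : ∀ c, IsSmoothEmbedding (𝓡 m) (𝓡 (m + 1)) ∞ (e ∘ (Subtype.val : ↥(W c) → M)) :=
    fun c => isSmoothEmbedding_comp_subtypeVal_opens (W c) he
  have hside : ∀ c, ∃ A B : Set (EuclideanSpace ℝ (Fin (m + 1))), IsOpen A ∧ IsOpen B ∧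
      Disjoint A B ∧ A ∪ B = (range (e ∘ (Subtype.val : ↥(W c) → M)))ᶜ ∧
      range (e ∘ (Subtype.val : ↥(W c) → M)) ⊆ closure A ∧
      range (e ∘ (Subtype.val : ↥(W c) → M)) ⊆ closure B ∧ Bornology.IsBounded A := fun c =>
    exists_sides_of_not_isPreconnected (hec c) hm (hsep _ _ (hec c))
  choose A B hAo hBo hAB hcov hclA hclB hAbdd using hside
  have hg : ∀ c, ∃ g : EuclideanSpace ℝ (Fin (m + 1)) → ℝ, ContDiff ℝ ∞ g ∧
      (∀ x, g x = 0 ↔ x ∈ range (e ∘ (Subtype.val : ↥(W c) → M))) ∧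
      (∀ x, g x = 0 → fderiv ℝ g x ≠ 0) ∧ (∀ x ∈ A c, g x < 0) ∧ (∀ x ∈ B c, 0 < g x) ∧
      ∃ R : ℝ, ∀ x, R ≤ ‖x‖ → g x = 1 := fun c =>
    exists_definingFunction_of_sides (hec c) (hAo c) (hBo c) (hAB c) (hcov c) (hclA c) (hclB c)
      (hAbdd c)
  choose g hgs hgZ hgreg _hgA _hgB R hR using hg
  -- membership in the component images
  have hmem : ∀ c x, x ∈ range (e ∘ (Subtype.val : ↥(W c) → M)) ↔
      ∃ y, ConnectedComponents.mk y = c ∧ e y = x := by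
    intro c x
    constructor
    · rintro ⟨⟨y, hy⟩, rfl⟩; exact ⟨y, hy, rfl⟩
    · rintro ⟨y, hy, rfl⟩; exact ⟨⟨y, hy⟩, rfl⟩
  -- the product
  refine ⟨fun x => ∏ c, g c x, contDiff_prod fun c _ => hgs c, fun x => ?_, fun x hx => ?_,
    ∑ c, |R c|, fun x hx => ?_⟩
  · rw [Finset.prod_eq_zero_iff]
    constructor
    · rintro ⟨c, -, hc⟩
      obtain ⟨y, -, rfl⟩ := (hmem c x).1 ((hgZ c x).1 hc)
      exact ⟨y, rfl⟩
    · rintro ⟨y, rfl⟩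
      exact ⟨ConnectedComponents.mk y, Finset.mem_univ _,
        (hgZ _ _).2 ((hmem _ _).2 ⟨y, rfl, rfl⟩)⟩
  · -- regularity: only the factor of the component through `x` vanishes
    obtain ⟨c₀, -, hc₀⟩ := Finset.prod_eq_zero_iff.1 hx
    obtain ⟨y₀, hy₀, rfl⟩ := (hmem c₀ _).1 ((hgZ c₀ _).1 hc₀)
    have hothers : ∀ c, c ≠ c₀ → g c (e y₀) ≠ 0 := by
      intro c hc h0
      obtain ⟨y, hy, hye⟩ := (hmem c _).1 ((hgZ c _).1 h0)
      rw [hinj hye] at hy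
      exact hc (hy.symm.trans hy₀)
    have heq : (fun x => ∏ c, g c x) = fun x => g c₀ x * ∏ c ∈ Finset.univ.erase c₀, g c x := by
      funext x; rw [Finset.mul_prod_erase Finset.univ (fun c => g c x) (Finset.mem_univ c₀)]
    have hd₀ : DifferentiableAt ℝ (g c₀) (e y₀) :=
      (hgs c₀).contDiffAt.differentiableAt (by simp)
    have hd₁ : DifferentiableAt ℝ (fun x => ∏ c ∈ Finset.univ.erase c₀, g c x) (e y₀) :=
      (contDiff_prod fun c _ => hgs c).contDiffAt.differentiableAt (by simp)
    rw [heq, fderiv_fun_mul hd₀ hd₁, hc₀, zero_smul, zero_add]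
    refine smul_ne_zero ?_ (hgreg c₀ _ hc₀)
    exact Finset.prod_ne_zero_iff.2 fun c hc => hothers c (Finset.ne_of_mem_erase hc)
  · have h1 : ∀ c, g c x = 1 := fun c => hR c x (le_trans ((le_abs_self _).trans
      (Finset.single_le_sum (fun c _ => abs_nonneg (R c)) (Finset.mem_univ c))) hx)
    change (1 : ℝ) ≤ ∏ c, g c x
    rw [Finset.prod_eq_one fun c _ => h1 c]

/-! ### Dimension zero -/

/-- A compact manifold of dimension `0` is finite (its charts are injections into a point, so it
is discrete). [folklore] -/
theorem finite_of_chartedSpace_fin_zero (M : Type u) [TopologicalSpace M] [CompactSpace M]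
    [ChartedSpace (EuclideanSpace ℝ (Fin 0)) M] : Finite M := by
  haveI : DiscreteTopology M := by
    refine discreteTopology_iff_isOpen_singleton.mpr fun z => ?_
    have hsub : (chartAt (EuclideanSpace ℝ (Fin 0)) z).source ⊆ {z} := fun y hy =>
      (chartAt (EuclideanSpace ℝ (Fin 0)) z).injOn hy (mem_chart_source _ z)
        (Subsingleton.elim _ _)
    have heq : (chartAt (EuclideanSpace ℝ (Fin 0)) z).source = {z} :=
      hsub.antisymm (singleton_subset_iff.mpr (mem_chart_source _ z))
    exact heq ▸ (chartAt (EuclideanSpace ℝ (Fin 0)) z).open_source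
  exact finite_of_compact_of_discrete

/-- **Seifert's theorem in dimension `0`**: finitely many points `e(M) ⊂ ℝ¹` are the simple
zeros of `f = ∏_y (X - e(y))`, and the constant family is an isotopy. [folklore] -/
theorem Seifert1936_algebraicModel_dim_zero (M : Type u) [TopologicalSpace M] [T2Space M]
    [SecondCountableTopology M] [CompactSpace M] [ChartedSpace (EuclideanSpace ℝ (Fin 0)) M]
    [IsManifold (𝓡 0) ∞ M] (e : M → EuclideanSpace ℝ (Fin (0 + 1)))
    (he : IsSmoothEmbedding (𝓡 0) (𝓡 (0 + 1)) ∞ e) :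
    ∃ (f : MvPolynomial (Fin (0 + 1)) ℝ) (e' : M → EuclideanSpace ℝ (Fin (0 + 1)))
      (H : ℝ → M → EuclideanSpace ℝ (Fin (0 + 1))),
      IsNonsingularAlongZeroSet (0 + 1) f ∧
      IsSmoothEmbedding (𝓡 0) (𝓡 (0 + 1)) ∞ e' ∧ range e' = realZeroSet (0 + 1) f ∧
      H 0 = e ∧ H 1 = e' ∧
      ContMDiff (𝓘(ℝ, ℝ).prod (𝓡 0)) (𝓡 (0 + 1)) ∞ (uncurry H) ∧
      ∀ t : ℝ, IsSmoothEmbedding (𝓡 0) (𝓡 (0 + 1)) ∞ (H t) := by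
  classical
  haveI : Finite M := finite_of_chartedSpace_fin_zero M
  haveI : Fintype M := Fintype.ofFinite M
  have hinj : Injective e := he.isEmbedding.injective
  -- points of the line are determined by their coordinate
  have hext : ∀ x x' : EuclideanSpace ℝ (Fin (0 + 1)), x = x' ↔ x 0 = x' 0 := fun x x' =>
    ⟨fun h => by rw [h], fun h => PiLp.ext fun i => by
      obtain ⟨i, hi⟩ := i
      have hi0 : i = 0 := by omega
      subst hi0
      exact h⟩
  set f : MvPolynomial (Fin (0 + 1)) ℝ := ∏ y : M, (X 0 - C (e y 0)) with hf_def
  have heval : ∀ x : EuclideanSpace ℝ (Fin (0 + 1)),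
      eval (WithLp.ofLp x) f = ∏ y : M, (x 0 - e y 0) := fun x => by
    simp [hf_def, map_prod]
  have hzero : ∀ x : EuclideanSpace ℝ (Fin (0 + 1)), eval (WithLp.ofLp x) f = 0 ↔ x ∈ range e := by
    intro x
    rw [heval, Finset.prod_eq_zero_iff]
    constructor
    · rintro ⟨y, -, hy⟩
      exact ⟨y, ((hext _ _).2 (sub_eq_zero.1 hy).symm)⟩
    · rintro ⟨y, rfl⟩
      exact ⟨y, Finset.mem_univ _, sub_self _⟩
  -- nonsingularity: at `e y₀` only one factor vanishes
  have hreg : ∀ x : EuclideanSpace ℝ (Fin (0 + 1)), eval (WithLp.ofLp x) f = 0 →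
      fderiv ℝ (fun z : EuclideanSpace ℝ (Fin (0 + 1)) => eval (WithLp.ofLp z) f) x ≠ 0 := by
    intro x hx
    obtain ⟨y₀, rfl⟩ := (hzero x).1 hx
    have hfun : (fun z : EuclideanSpace ℝ (Fin (0 + 1)) => eval (WithLp.ofLp z) f) =
        fun z => (z 0 - e y₀ 0) * ∏ y ∈ Finset.univ.erase y₀, (z 0 - e y 0) := by
      funext z
      rw [heval, Finset.mul_prod_erase Finset.univ (fun y => z 0 - e y 0) (Finset.mem_univ y₀)]
    have hcd : ∀ a : ℝ, ContDiff ℝ ∞ (fun z : EuclideanSpace ℝ (Fin (0 + 1)) => z 0 - a) :=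
      fun a => (PiLp.proj (𝕜 := ℝ) 2 (fun _ : Fin (0 + 1) => ℝ) 0).contDiff.sub contDiff_const
    have hd0 : ∀ a : ℝ, DifferentiableAt ℝ (fun z : EuclideanSpace ℝ (Fin (0 + 1)) => z 0 - a)
        (e y₀) := fun a => (hcd a).contDiffAt.differentiableAt (by simp)
    have hd1 : DifferentiableAt ℝ
        (fun z : EuclideanSpace ℝ (Fin (0 + 1)) => ∏ y ∈ Finset.univ.erase y₀, (z 0 - e y 0))
        (e y₀) :=
      (contDiff_prod fun y _ => hcd (e y 0)).contDiffAt.differentiableAt (by simp)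
    rw [hfun, fderiv_fun_mul (hd0 _) hd1]
    simp only [sub_self, zero_smul, zero_add]
    refine smul_ne_zero ?_ ?_
    · refine Finset.prod_ne_zero_iff.2 fun y hy h0 => Finset.ne_of_mem_erase hy ?_
      exact hinj ((hext _ _).2 (sub_eq_zero.1 h0).symm)
    · intro hD
      have h1 : fderiv ℝ (fun z : EuclideanSpace ℝ (Fin (0 + 1)) => z 0 - e y₀ 0) (e y₀)
          (EuclideanSpace.single 0 1) = 1 := by
        rw [fderiv_sub_const, (PiLp.hasFDerivAt_apply 2 (e y₀) 0).fderiv]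
        simp
      rw [hD] at h1
      simp at h1
  refine ⟨f, e, fun _ => e, isNonsingularAlongZeroSet_of_fderiv_ne_zero hreg, he, ?_, rfl, rfl,
    he.contMDiff.comp contMDiff_snd, fun _ => he⟩
  ext x
  rw [mem_realZeroSet]
  exact ((hzero x).symm)

/-! ### Seifert's theorem from the separation property -/

/-- **Seifert's theorem, given the Jordan–Brouwer separation property** (Akbulut–King, Thm. 2.8.2
for `V = ℝⁿ`; everything in the printed proof except the sentence "there is a compact set `N`
so that `M` is the frontier of `N`" of Assertion 2.8.2.1 is proved in the tree): if for every
`m ≥ 1` every compact connected smoothly embedded `m`-manifold separates `ℝᵐ⁺¹`, then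
`Seifert1936_algebraicModel` holds.
[cite: AkbulutKing1992, Thm. 2.8.2 (V = ℝⁿ) and Ch. II §10 ¶1] -/
theorem Seifert1936_algebraicModel_of_separation
    (hsep : ∀ (m : ℕ), 1 ≤ m → ∀ (M : Type u) [TopologicalSpace M] [CompactSpace M]
      [ConnectedSpace M] [ChartedSpace (EuclideanSpace ℝ (Fin m)) M] [IsManifold (𝓡 m) ∞ M]
      (e : M → EuclideanSpace ℝ (Fin (m + 1))),
      IsSmoothEmbedding (𝓡 m) (𝓡 (m + 1)) ∞ e → ¬ IsPreconnected (range e)ᶜ) :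
    Seifert1936_algebraicModel.{u} := by
  intro m M _ _ _ _ _ _ e he
  rcases Nat.eq_zero_or_pos m with rfl | hm
  · exact Seifert1936_algebraicModel_dim_zero M e he
  · obtain ⟨g, hg, hgZ, hreg, R, hfar⟩ :=
      exists_definingFunction_of_separation hm (hsep m hm) e he
    exact Seifert1936_algebraicModel_of_definingFunction m M e he g hg hgZ hreg hfar

end Literature.Topology.FourManifolds
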